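import Summits.CriticalPhenomena.CardyFormulaZ2.Theses.CardySelfRefinement
import Literature.Probability.Percolation.KSTPeriodicCascadeStep
import HarnessLib.Audit

/-!
# Crux `CriticalPathRSW`, line finite-size-envelope: stub `stub_kstCascadeStepPos`

The cascading step of [KohlerSchindlerTassion2023, Lemma 4] for the weak periodic RSW theorem at
positive bottom scale (`KSTPeriodic.CascadeStepPos` of `KSTPeriodicStatements.lean`), from the
corridor lemma `KSTPeriodic.CorridorB`, for periods `k ≥ 1` and offsets `t ≤ k`: a wrapper around
`KSTPeriodic.cascadeStepPos_of_corridorB`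
(`Literature/Probability/Percolation/KSTPeriodicCascadeStep.lean`).
-/

namespace Summit.CriticalPhenomena.CardyFormulaZ2.Cruxes.CriticalPathRSW.FiniteSizeEnvelope

open Literature.Probability.Percolation

/-- **Registered stub `stub_kstCascadeStepPos`** of the line `finite-size-envelope`: the corridor
lemma (vertical crosser) implies the cascading inequality of Lemma 4 at all positive scales.
[cite: KohlerSchindlerTassion2023, Lemma 4 and Comment 1] -/
theorem stub_kstCascadeStepPos :
    ∀ k t : ℕ, 1 ≤ k → t ≤ k → KSTPeriodic.CorridorB → KSTPeriodic.CascadeStepPos k t :=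
  fun _ _ hk htk hCo => KSTPeriodic.cascadeStepPos_of_corridorB hk htk hCo

end Summit.CriticalPhenomena.CardyFormulaZ2.Cruxes.CriticalPathRSW.FiniteSizeEnvelope
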